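import Literature.Computability.Complexity.ACFourierTails
import Literature.Computability.Complexity.YaoNextBit

/-!
# Route OneSlice, crux `SliceACZero` (stmt-PneNP-2835), line `russo-window-ladder`: stub `stub_influenceFourier`

The Fourier formula for the total influence on `{0,1}^m` (O'Donnell 2014, Prop. 2.24 / Thm 2.38):
`I[f] = #upPivotal(f) · 2^{1−m} = Σ_{k=1}^{m} W^{≥k}[g] = Σ_S |S| ĝ(S)²` for `g = sgn ∘ f`, in the tree's
`cubeFourierCoeff` / `tailWeight` normalisation (`BooleanFourier.lean`, `FourierTails.lean`). Route: the flip lemma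
`cubeFourierCoeff_flipAt` (`(g ∘ flip_i)^(S) = (−1)^{[i∈S]} ĝ(S)`), Parseval on `g − g ∘ flip_i`
(`Σ_{S ∋ i} ĝ(S)² = #{x : f x ≠ f(x^{⊕i})}/2^m = 2·#upPivotal_i/2^m`), and `Σ_S |S| ĝ(S)² = Σ_{k=1}^{m} W^{≥k}`
(`sum_choose_mul_sq_eq_sum_tailWeight` at `k = 1`); the coordinate flip is the tree's `YaoNB.flipAt`. The registered stub `stub_influenceFourier` (skeleton
`Cruxes/SliceACZero/Lines/russo-window-ladder.lean`, consumed by `boppana_of`) is the last theorem; its left side is the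
line's `biasedInfluence (1/2) f` written out.

Proofs adapted from the refuter's kernel-checked candidate `Cruxes/SliceACZero/DrefuteG3RussoWindowLadderComplete.lean`
(refuter-drefute-stmt-PneNP-2835-g3-0, namespace `…DrefuteG3Complete.S4a`), relocated to the line namespace.
-/

noncomputable section

namespace Summit.PneNP.PneNP.Cruxes.SliceACZero.RussoWindowLadder

set_option linter.dupNamespace false

namespace InfluenceFourier

open Finset Literature.Computability.Complexity Literature.Computability.Complexity.LowDegree
open Literature.Probability.RandomGraphs.LowDegree (sgn walsh)
open Literature.Computability.Complexity.YaoNB (flipAt flipAt_flipAt)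

variable {m : ℕ}

/-- Value of the flipped point at `i` (`flipAt` = `Literature.Computability.Complexity.YaoNB.flipAt`,
`flipAt i x = Function.update x i (!x i)`). [folklore] -/
theorem flipAt_apply_same (i : Fin m) (x : Fin m → Bool) : flipAt i x i = !x i := by
  simp [flipAt]

/-- Value of the flipped point off `i`. [folklore] -/
theorem flipAt_apply_ne {i j : Fin m} (h : j ≠ i) (x : Fin m → Bool) : flipAt i x j = x j := by
  simp [flipAt, h]

/-- A character at the flipped point: `χ_S(x^{⊕i}) = (-1)^{[i∈S]} χ_S(x)`. [cite: ODonnell2014, §1.2] -/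
theorem walsh_flipAt (S : Finset (Fin m)) (i : Fin m) (x : Fin m → Bool) :
    walsh S (flipAt i x) = (if i ∈ S then -1 else 1) * walsh S x := by
  unfold walsh
  by_cases hi : i ∈ S
  · rw [if_pos hi, ← Finset.mul_prod_erase S (fun j => sgn (flipAt i x j)) hi,
      ← Finset.mul_prod_erase S (fun j => sgn (x j)) hi, flipAt_apply_same, ACForm.sgn_not]
    have : ∏ j ∈ S.erase i, sgn (flipAt i x j) = ∏ j ∈ S.erase i, sgn (x j) :=
      Finset.prod_congr rfl fun j hj => by rw [flipAt_apply_ne (Finset.ne_of_mem_erase hj)]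
    rw [this]; ring
  · rw [if_neg hi, one_mul]
    exact Finset.prod_congr rfl fun j hj => by rw [flipAt_apply_ne (by rintro rfl; exact hi hj)]

/-- **Coefficients of the flipped function**: `(g ∘ flip_i)^(S) = (-1)^{[i∈S]} ĝ(S)`. [cite: ODonnell2014, §1.2] -/
theorem cubeFourierCoeff_flipAt (g : (Fin m → Bool) → ℝ) (i : Fin m) (S : Finset (Fin m)) :
    cubeFourierCoeff (fun x => g (flipAt i x)) S = (if i ∈ S then -1 else 1) * cubeFourierCoeff g S := by
  unfold cubeFourierCoeff
  rw [mul_div_assoc']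
  congr 1
  have hinv : Function.Involutive (flipAt i : (Fin m → Bool) → (Fin m → Bool)) := flipAt_flipAt i
  have hc2 : ((if i ∈ S then (-1 : ℝ) else 1) * (if i ∈ S then (-1 : ℝ) else 1)) = 1 := by
    split_ifs <;> norm_num
  calc ∑ x, g (flipAt i x) * walsh S x
      = ∑ x, (fun y => (if i ∈ S then (-1 : ℝ) else 1) * (g y * walsh S y)) (flipAt i x) := by
          refine Finset.sum_congr rfl fun x _ => ?_
          simp only
          rw [walsh_flipAt]
          calc g (flipAt i x) * walsh S x
              = ((if i ∈ S then (-1 : ℝ) else 1) * (if i ∈ S then (-1 : ℝ) else 1)) *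
                  (g (flipAt i x) * walsh S x) := by rw [hc2, one_mul]
            _ = _ := by ring
    _ = ∑ y, (if i ∈ S then (-1 : ℝ) else 1) * (g y * walsh S y) :=
          Equiv.sum_comp (hinv.toPerm _) (fun y => (if i ∈ S then (-1 : ℝ) else 1) * (g y * walsh S y))
    _ = (if i ∈ S then (-1 : ℝ) else 1) * ∑ y, g y * walsh S y := by rw [← Finset.mul_sum]

/-- **`Inf_i` in Fourier** (O'Donnell Prop. 2.24, `{0,1}^m` form): `Σ_{S ∋ i} ĝ(S)² = #{x : f x ≠ f(x^{⊕i})}/2^m`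
for `g = sgn ∘ f`. [cite: ODonnell2014, Proposition 2.24] -/
theorem sum_sq_coeff_mem (f : (Fin m → Bool) → Bool) (i : Fin m) :
    ∑ S ∈ univ.filter (fun S : Finset (Fin m) => i ∈ S), cubeFourierCoeff (fun x => sgn (f x)) S ^ 2 =
      (#(univ.filter fun x : Fin m → Bool => f x ≠ f (flipAt i x)) : ℝ) / 2 ^ m := by
  set g : (Fin m → Bool) → ℝ := fun x => sgn (f x) with hg
  set h : (Fin m → Bool) → ℝ := fun x => g x - g (flipAt i x) with hh
  have hcoef : ∀ S, cubeFourierCoeff h S = if i ∈ S then 2 * cubeFourierCoeff g S else 0 := by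
    intro S
    rw [hh, cubeFourierCoeff_sub g (fun x => g (flipAt i x)), cubeFourierCoeff_flipAt]
    split_ifs <;> ring
  have hpars := sum_cubeFourierCoeff_sq h
  have hl : ∑ S, cubeFourierCoeff h S ^ 2 =
      4 * ∑ S ∈ univ.filter (fun S : Finset (Fin m) => i ∈ S), cubeFourierCoeff g S ^ 2 := by
    have e : ∀ S, cubeFourierCoeff h S ^ 2 = if i ∈ S then 4 * cubeFourierCoeff g S ^ 2 else 0 := by
      intro S; rw [hcoef]; split_ifs <;> ring
    simp_rw [e]
    rw [← Finset.sum_filter, Finset.mul_sum]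
  have hr : ∑ x, h x ^ 2 = 4 * (#(univ.filter fun x : Fin m → Bool => f x ≠ f (flipAt i x)) : ℝ) := by
    have e : ∀ x, h x ^ 2 = if f x ≠ f (flipAt i x) then 4 else 0 := by
      intro x
      simp only [hh, hg]
      cases f x <;> cases f (flipAt i x) <;> norm_num [sgn]
    simp_rw [e]
    rw [← Finset.sum_filter, Finset.sum_const, nsmul_eq_mul, mul_comm]
  rw [hl, hr] at hpars
  have h4 : (4 : ℝ) * ∑ S ∈ univ.filter (fun S : Finset (Fin m) => i ∈ S), cubeFourierCoeff g S ^ 2 =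
      4 * ((#(univ.filter fun x : Fin m → Bool => f x ≠ f (flipAt i x)) : ℝ) / 2 ^ m) := by
    rw [hpars]; ring
  linarith

/-- Each pivotal edge in direction `i` is seen from both endpoints:
`#{x : f x ≠ f(x^{⊕i})} = 2 · #{x : x_i = 0, f x ≠ f(x^{i→1})}`. [folklore] -/
theorem card_ne_flipAt (f : (Fin m → Bool) → Bool) (i : Fin m) :
    #(univ.filter fun x : Fin m → Bool => f x ≠ f (flipAt i x)) =
      2 * #(univ.filter fun x : Fin m → Bool => x i = false ∧ f x ≠ f (Function.update x i true)) := by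
  set A := univ.filter fun x : Fin m → Bool => f x ≠ f (flipAt i x) with hA
  set P := univ.filter fun x : Fin m → Bool => x i = false ∧ f x ≠ f (Function.update x i true) with hP
  have hsplit := Finset.card_filter_add_card_filter_not (s := A) (fun x : Fin m → Bool => x i = false)
  have hup : ∀ x : Fin m → Bool, x i = false → flipAt i x = Function.update x i true := by
    intro x hx; rw [flipAt, hx]; rfl
  have h1 : A.filter (fun x => x i = false) = P := by
    ext x
    simp only [hA, hP, Finset.mem_filter, Finset.mem_univ, true_and]
    constructor
    · rintro ⟨h, hx⟩; exact ⟨hx, by rwa [hup x hx] at h⟩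
    · rintro ⟨hx, h⟩; exact ⟨by rwa [hup x hx], hx⟩
  have h2 : #(A.filter (fun x => ¬ x i = false)) = #P := by
    refine Finset.card_bij' (fun x _ => flipAt i x) (fun x _ => flipAt i x) ?_ ?_
      (fun x _ => flipAt_flipAt i x) (fun x _ => flipAt_flipAt i x)
    · intro x hx
      simp only [hA, Finset.mem_filter, Finset.mem_univ, true_and] at hx
      obtain ⟨hne, hxi⟩ := hx
      have hxi' : x i = true := by cases hx : x i <;> simp_all
      have hfx : flipAt i x i = false := by rw [flipAt_apply_same, hxi']; rfl
      simp only [hP, Finset.mem_filter, Finset.mem_univ, true_and]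
      refine ⟨hfx, ?_⟩
      rw [← hup _ hfx, flipAt_flipAt]
      exact fun h => hne h.symm
    · intro x hx
      simp only [hP, Finset.mem_filter, Finset.mem_univ, true_and] at hx
      obtain ⟨hxi, hne⟩ := hx
      simp only [hA, Finset.mem_filter, Finset.mem_univ, true_and]
      refine ⟨?_, by rw [flipAt_apply_same, hxi]; decide⟩
      rw [flipAt_flipAt, hup x hxi]
      exact fun h => hne h.symm
  rw [h1, h2] at hsplit
  omega

/-- `Σ_{k=1}^{m} W^{≥k}[g] = Σ_S |S| ĝ(S)²`. [cite: Tal2017, Lemma 2.14] -/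
theorem sum_Icc_tailWeight (g : (Fin m → Bool) → ℝ) :
    ∑ k ∈ Finset.Icc 1 m, tailWeight g k = ∑ S : Finset (Fin m), (S.card : ℝ) * cubeFourierCoeff g S ^ 2 := by
  have h := sum_choose_mul_sq_eq_sum_tailWeight g (le_refl 1)
  simp only [Nat.choose_one_right, Nat.sub_self, Nat.choose_zero_right, Nat.cast_one, one_mul] at h
  rw [h]
  symm
  refine Finset.sum_nbij' (fun d => d + 1) (fun k => k - 1) ?_ ?_ ?_ ?_ ?_
  · intro d hd; simp only [Finset.mem_range] at hd; simp only [Finset.mem_Icc]; omega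
  · intro k hk; simp only [Finset.mem_Icc] at hk; simp only [Finset.mem_range]; omega
  · intro d hd; simp
  · intro k hk; simp only [Finset.mem_Icc] at hk; omega
  · intro d hd; rfl

/-- The identity of the stub, inner form (all `m`; `m = 0`: both sides vanish). [cite: ODonnell2014, Proposition 2.24] -/
theorem influenceFourier :
    ∀ (m : ℕ) (f : (Fin m → Bool) → Bool),
      (∑ p ∈ (univ.filter fun p : (Fin m → Bool) × Fin m =>
          p.1 p.2 = false ∧ f p.1 ≠ f (Function.update p.1 p.2 true)),
        (1 / 2 : ℝ) ^ #(univ.filter fun i => p.1 i = true) *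
          (1 - 1 / 2 : ℝ) ^ (Fintype.card (Fin m) - 1 - #(univ.filter fun i => p.1 i = true))) =
      ∑ k ∈ Finset.Icc 1 m, tailWeight (fun x => sgn (f x)) k := by
  intro m f
  rcases Nat.eq_zero_or_pos m with rfl | hm
  · simp
  -- the pivotal set in direction `i`
  set P : Fin m → Finset (Fin m → Bool) :=
    fun i => univ.filter fun x : Fin m → Bool => x i = false ∧ f x ≠ f (Function.update x i true) with hP
  set F := univ.filter fun p : (Fin m → Bool) × Fin m =>
    p.1 p.2 = false ∧ f p.1 ≠ f (Function.update p.1 p.2 true) with hF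
  have hhalf : (1 / 2 : ℝ) ^ (m - 1) = 2 / 2 ^ m := by
    obtain ⟨m', rfl⟩ : ∃ m', m = m' + 1 := ⟨m - 1, by omega⟩
    rw [Nat.add_sub_cancel, one_div_pow, pow_succ, div_eq_div_iff (by positivity) (by positivity)]; ring
  -- Step 1: every term of the left sum is `(1/2)^{m-1}`
  have hL : ∑ p ∈ F, (1 / 2 : ℝ) ^ #(univ.filter fun i => p.1 i = true) *
        (1 - 1 / 2 : ℝ) ^ (Fintype.card (Fin m) - 1 - #(univ.filter fun i => p.1 i = true)) =
      ∑ p ∈ F, (1 / 2 : ℝ) ^ (m - 1) := by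
    refine Finset.sum_congr rfl fun p hp => ?_
    simp only [hF, Finset.mem_filter, Finset.mem_univ, true_and] at hp
    have hle : #(univ.filter fun i => p.1 i = true) ≤ m - 1 := by
      have hsub : (univ.filter fun i => p.1 i = true) ⊆ univ.erase p.2 := by
        intro i hi
        simp only [Finset.mem_filter, Finset.mem_univ, true_and] at hi
        exact Finset.mem_erase.2 ⟨fun h => by rw [h, hp.1] at hi; exact Bool.false_ne_true hi, mem_univ _⟩
      have := Finset.card_le_card hsub
      rwa [Finset.card_erase_of_mem (mem_univ _), Finset.card_univ, Fintype.card_fin] at this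
    rw [Fintype.card_fin, show (1 - 1 / 2 : ℝ) = 1 / 2 by norm_num, ← pow_add]
    congr 1
    omega
  -- Step 2: `#F = Σ_i #P_i`
  have hcardF : (#F : ℝ) = ∑ i : Fin m, (#(P i) : ℝ) := by
    have : #F = ∑ i : Fin m, #(P i) := by
      rw [hF, Finset.card_filter, Fintype.sum_prod_type_right]
      refine Finset.sum_congr rfl fun i _ => ?_
      rw [hP, Finset.card_filter]
    rw [this]; push_cast; rfl
  -- Step 3: the right side
  have hR : ∑ k ∈ Finset.Icc 1 m, tailWeight (fun x => sgn (f x)) k = ∑ i : Fin m, 2 * (#(P i) : ℝ) / 2 ^ m := by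
    rw [sum_Icc_tailWeight]
    have e : ∀ S : Finset (Fin m), (S.card : ℝ) * cubeFourierCoeff (fun x => sgn (f x)) S ^ 2 =
        ∑ i ∈ S, cubeFourierCoeff (fun x => sgn (f x)) S ^ 2 := by
      intro S; rw [Finset.sum_const, nsmul_eq_mul]
    simp_rw [e]
    rw [Finset.sum_comm' (t' := univ) (s' := fun i => univ.filter fun S : Finset (Fin m) => i ∈ S)
      (fun S i => by simp)]
    refine Finset.sum_congr rfl fun i _ => ?_
    rw [sum_sq_coeff_mem, card_ne_flipAt]
    push_cast; ring
  rw [hL, Finset.sum_const, nsmul_eq_mul, hcardF, hR, Finset.sum_mul]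
  refine Finset.sum_congr rfl fun i _ => ?_
  rw [hhalf]; ring

end InfluenceFourier

open Finset
open Literature.Computability.Complexity.LowDegree (tailWeight)
open Literature.Probability.RandomGraphs.LowDegree (sgn)

/-- **Stub 4a — Fourier formula for the total influence** (registered stub of the line `russo-window-ladder`):
for every Boolean `f` on `{0,1}^m`, `#upPivotal(f) · 2^{1−m} = Σ_{k=1}^{m} W^{≥k}[sgn ∘ f]` (the left side is
`biasedInfluence (1/2) f` unfolded). [cite: ODonnell2014, Proposition 2.24] -/
theorem stub_influenceFourier :
    ∀ (m : ℕ) (f : (Fin m → Bool) → Bool),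
      (∑ p ∈ (univ.filter fun p : (Fin m → Bool) × Fin m =>
          p.1 p.2 = false ∧ f p.1 ≠ f (Function.update p.1 p.2 true)),
        (1 / 2 : ℝ) ^ #(univ.filter fun i => p.1 i = true) *
          (1 - 1 / 2 : ℝ) ^ (Fintype.card (Fin m) - 1 - #(univ.filter fun i => p.1 i = true))) =
      ∑ k ∈ Finset.Icc 1 m, tailWeight (fun x => sgn (f x)) k :=
  InfluenceFourier.influenceFourier

end Summit.PneNP.PneNP.Cruxes.SliceACZero.RussoWindowLadder

end
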